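import Literature.MathematicalPhysics.QuantumFieldTheory.Balaban1983to89.T4WeightBudget
import Literature.Probability.LatticeModels.PolymerGasRatio

/-!
# `Balaban1983to89.T4WeightBudgetKP` — node U5c of the uniqueness spine (T4-DAG v2 §2/§5, row T4-U5c.E, self-proposed
kernel sub-row T4-U5c.E-KP): the RELATIVE-WEIGHT EXTRACTION of NE7b (cell record `t4/T4-EST-U5c.md` v1.1, sub-estimate R3)
SPLIT into an abstract half that is a THEOREM of the tree's Kotecký–Preiss layer and a representation half that is a
HYPOTHESIS SHAPE — for the audit cell `pub-balaban` (Bałaban YM₄ ultraviolet stability, CMP 1983–89).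

WHAT THIS MODULE IS.  `T4WeightBudget.RelWeightBound l₀ T A B Bad W` (row T4-U5c.E, tree `T4WeightBudget`) is the
OUTPUT SHAPE node U5 consumes: per run and per step `K`, at every `|t| ≤ l₀`, the bad class of hybrid terms has relative
weight `≤ W K`, `0 ≤ W K < 1`, `Σ_K W K < ∞`.  The cell record T4-EST-U5c.md isolates as the one step of NE7b that no
paper of the series prints the *relative-weight extraction* R3: turning per-component smallness of old pending large-field
structures into a bound on the weight of the histories containing one, RELATIVE to the full sum of the same run.  This
module shows that R3 factors as

* (R3a, PROVED here, §1) an ABSTRACT PINNED-CLASS BOUND: for a hard-core polymer gas with non-negative real activities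
  on a Kotecký–Preiss volume `Λ` and any "pinned" set of polymers `D ⊆ Λ`, the weight of the compatible families meeting
  `D`, `bad := Z(Λ) − Z(Λ ∖ D)`, satisfies `0 ≤ bad ≤ (1 − exp(−Σ_{γ ∈ D} ‖w γ‖ e^{a γ})) · Z(Λ)` — a corollary of the
  telescoped ratio bound `exp(−Σ_{γ∈D} ‖w γ‖e^{a γ}) ≤ ‖Z(Λ ∖ D)/Z(Λ)‖` PROVED in the tree
  (`Literature.Probability.LatticeModels.le_norm_polymerPartitionFunction_sdiff_div_of_kp`, module `ClusterExpansion`,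
  from R. Kotecký, D. Preiss, Commun. Math. Phys. **103** (1986) 491–498 [KoteckyPreiss1986], Theorem p. 492 — the
  published abstract setting: *"To stress that the formulation as well as the proof do not depend on details of 'geometry
  of polymers' we state our theorem in an abstract setting."* [T, p. 492]); packaged as the bundled `PinnedGas` with
  `PinnedGas.bad_le_of_kp`;
* (R3b, HYPOTHESIS SHAPE, NOT PRINTED, NOT ASSERTED, §2) a REPRESENTATION `PolymerRep l₀ T A Bad S`: at each fixed
  `(K, t)`, `|t| ≤ l₀`, the run's family of hybrid term weights is a non-negative multiple of a KP pinned gas whose bad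
  class is the set of families meeting the pinned polymers `D_K` (the large-field structures created before the recent
  window and still pending at the end) and whose pinned size `Σ_{γ ∈ D_K} ‖w γ‖e^{a γ}` is `≤ S K`;

and proves the LIAISON (§2): `PolymerRep` for both runs with a common `S ≥ 0`, `Σ S < ∞` ⇒
`RelWeightBound l₀ T A B Bad (fun K ↦ 1 − exp(−S K))` (`relWeightBound_of_polymerRep`) — `W K < 1` is AUTOMATIC
(zero-freeness), `Σ W ≤ Σ S` (`summable_weightKP`), and the crossover weight slot is `−log(1 − W K) = S K` EXACTLY (`neg_log_one_sub_weightKP`,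
`crossoverDelta_kpSlot`), so that `T4WeightBudget.cauchySum_of_crossover_relWeightBound` runs with the slot `S K / vol`
(`cauchySum_of_crossover_polymerRep`).  CONSEQUENCE FOR THE AUDIT (GAPS G-pv14-7 (a) sharpened): the unprinted content of
R3 is NOT the extraction — that is kernel mathematics over a 1986 published theorem — but the REPRESENTATION R3b.

v2 (APPEND-ONLY over v1: §0–§3 byte-identical; answers the cross-read XREAD ok-with-remark C-pv05g5-5 / typing objection
G-pv05g5-3 «R3b correctly LOCATED, OVER-TYPED»).  §4 adds R3b in the form NE7b actually needs — DOMINATION, not exact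
representation: `PolymerDom l₀ T A Bad S` asks, at each fixed `(K, t)`, only for a KP pinned gas `G` and `c ≥ 0` with
`Σ_{Bad} A ≤ c · G.bad` and `c · G.total ≤ Σ_{T} A` (pinned size `≤ S K`).  Reason (G-pv05g5-3, a reading this seat
endorses): in Bałaban's expansion distinct large-field structures are coupled SOFTLY (small-field action terms, the
ℝ-quotients, boundary terms whose localization domains touch several structures), so an EXACT hard-core factorisation of
the POSITIVE history weights exists only after a Mayer expansion of those couplings — which is what makes activities
signed ((1.91) p. 388 is that interpolation); `PolymerRep`'s exact equalities and the positivity I-2 pull against each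
other, while a Peierls-type conditional domination per pinned structure, uniform in the environment, is all the liaison
uses.  `PolymerRep → PolymerDom` (`PolymerRep.toDom`); `PolymerDom.bad_le`, `PolymerDom.mono`, `relWeightBound_of_polymerDom`,
`cauchySum_of_crossover_polymerDom` — same weights `1 − e^{−S K}`, same slot `S K / vol`.  Row T4-U5.E should instantiate
`PolymerDom` (with the slack index of GAPS G-pv05g5-2), not `PolymerRep`.  Still NOT PRINTED, still not asserted.

WHAT IS PRINTED TOWARDS R3b, AND WHAT IS NOT (render-read [R] by this seat on the ×2 PNG
`b2b-balaban-ref1/pages/1989-cmp122-large-field-II/1989-cmp122-large-field-II-p034-x2.png`, B16 = T. Bałaban, *Large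
field renormalization. II*, Commun. Math. Phys. **122** (1989) 355–392 [Balaban1989LargeFieldII], journal page = PDF
page + 354; B16 is a manuscript UNDER AUDIT, quoted for what it states, never as establishing a disputed step).  PRINTED,
per renormalization step: B16 p. 388 — *"For the fixed decomposition we resum all the expressions determining the same
components. We obtain the following polymer expansion {⋯} = 1 + Σ_{r≥1} Σ_{{X′₁,…,X′_r}} Π_{p=1}^{r} F(X′_p), (1.90) where
the activities F(X′) are defined by [(1.91)]"*, with compatibility = distinct components (*"we consider two such
components as connected, if they are contained in one localization domain Y of a term in the product"*), and the activity
bound *"To get a convergent exponentiated expansion of the right-hand side of (1.90), we have to obtain the bounds for the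
activities. Using (1.68), (1.73), (1.89), we obtain |F(X′)| ≤ Σ_q Σ′ Σ′_𝐃 Π_{h=1}^{q} exp(−2(1 + β₀)^{−1}p₀(g_k) + 1)·(Π_{Y∈𝐃}
α exp(−(1 + 2β)κd_{k,Z′}(Y))) exp Σ_{Y∈𝐃} α exp(−(1 + 2β)κd_{k,Z′}(Y)), (1.92)"* [R, p. 388] — a hard-core polymer gas of
exactly the `PolymerGas` type at ONE step, whose Kotecký–Preiss convergence is the tree's `B16Exp198` (kernel certificate
of (1.90) ⇒ (1.98)–(1.99)).  NOT PRINTED anywhere in B15/B16 (located absences: `t4/T4-XREAD-U5c.md` §3, `t4/T4-XREAD-U4.md`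
V6): (i) the HISTORY-indexed version at fixed `(K, t)` — the hybrid term family of T4-DAG §2 U5 (one term per admissible
history of large-field classes across the scales `0 … K`) written as ONE pinned polymer gas in which "contains a structure
created before scale `j⋆(K)` and pending at the end" is "meets `D_K`"; (ii) the non-negativity of the history-indexed
weights at real `t` (interface condition I-2 of T4-EST-U5c §0 (i)) — (1.91)'s activities are signed; (iii) the interaction
of the pinned class with the 𝐑-operation, which between scales EXPONENTIATES the activities of renormalised components into
the action ((1.98)), so that scale-`j` polymers are no longer polymers at scale `K`.  These three points ARE R3b; the
record T4-EST-U5c.md v1.2 §8 carries them as the precise objection.  No smallness enters this module: the pinned size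
`S K` is where R1 (banked induction (1.80⁺)), R2 (survival window) and R4 (entropy) of the record deliver
`S K ≤ V · r^{K − j⋆(K) + 1}/(1 − r)` (`T4WeightBudget.sum_range_pow_sub_le`, `summable_weightMajorant`).

WHAT THIS MODULE IS NOT.  Not a proof of NE7b or of any estimate about Bałaban's expansions; no quotation is asserted;
`PinnedGas` is abstract finite combinatorics and `PolymerRep` / `PolymerDom` (v2) are `Prop`-valued HYPOTHESIS SHAPES.  T4 typed modules are
NOT summit progress (cell custom).  Everything here is proved; no named facts.  [T] marks the one sentence of
[KoteckyPreiss1986] quoted from the held text layer `paper:doi-10-1007-bf01211762` p. 492 of the PUBLISHED paper (not a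
manuscript under audit; nothing of it is used as a hypothesis — the tree proves what it uses).

Mathlib anchors: `Real.add_one_le_exp`, `Real.exp_pos`, `Real.log_exp`, `Summable.of_nonneg_of_le`, `Complex.ext`,
`Complex.norm_real`, `le_div_iff₀`.  Tree anchors: `Literature.Probability.LatticeModels.polymerPartitionFunction`,
`IsKPVolume`, `kpTerm`, `le_norm_polymerPartitionFunction_sdiff_div_of_kp`, `re_polymerPartitionFunction_mono`,
`one_le_re_polymerPartitionFunction`, `im_polymerPartitionFunction_eq_zero` (all proved there);
`T4WeightBudget.RelWeightBound`, `crossoverDelta_weightSlot`, `cauchySum_of_crossover_relWeightBound`.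

References: [Balaban1989LargeFieldII] (1.90)–(1.92) p. 388 [R]; [Balaban1989LargeFieldI] T. Bałaban, *Large field
renormalization. I*, Commun. Math. Phys. **122** (1989) 175–202, p. 177 (locality of 𝐑, quoted in `T4WeightBudget`);
[KoteckyPreiss1986] Theorem p. 492 [T]; S. Friedli, Y. Velenik, *Statistical Mechanics of Lattice Systems* (CUP 2017)
Ch. 5, (5.29) (the telescoped ratio bound) [FriedliVelenik2017]; cell records `t4/T4-EST-U5c.md` v1.1 §0/§3 (R1–R5,
I-1/I-2/I-3), `t4/T4-XREAD-U5c.md` v1 (pv05-g5), GAPS G-pv12g4-1, G-pv14-7.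
-/

noncomputable section

open Finset _root_.Filter _root_.Topology
open _root_.Literature.Probability.LatticeModels

namespace Literature.MathematicalPhysics.QuantumFieldTheory.Balaban1983to89.T4WeightBudgetKP

open T4HybridMatching T4CauchySum T4Crossover T4WeightBudget

/-! ## §0 Real-number lemmas for the weight `W = 1 − e^{−S}` -/

/-- `1 − e^{−S} < 1`. [folklore] -/
theorem weightKP_lt_one (S : ℝ) : 1 - Real.exp (-S) < 1 := by
  have := Real.exp_pos (-S)
  linarith

/-- THE SLOT IDENTITY: `−log(1 − (1 − e^{−S})) = S` — with `W K := 1 − e^{−S K}` the crossover weight slot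
`(−log(1 − W K))/vol` of `T4Crossover.cauchySum_of_crossover` is `S K / vol` on the nose. [folklore] -/
theorem neg_log_one_sub_weightKP (S : ℝ) : -Real.log (1 - (1 - Real.exp (-S))) = S := by
  rw [sub_sub_cancel, Real.log_exp, neg_neg]

/-- Summability of the weights from summability of the pinned sizes: `0 ≤ 1 − e^{−S K} ≤ S K` (the two elementary
inequalities `0 ≤ 1 − e^{−s}` for `s ≥ 0` and `1 − e^{−s} ≤ s` are in the tree under other topics —
`DimockYuan2024.one_sub_exp_neg_nonneg`, `PrimeReciprocal.one_sub_exp_neg_le` — and are re-derived inline from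
`Real.exp_le_one_iff` / `Real.add_one_le_exp` rather than imported across topics). [folklore] -/
theorem summable_weightKP {S : ℕ → ℝ} (hS0 : ∀ K, 0 ≤ S K) (hS : Summable S) :
    Summable (fun K => 1 - Real.exp (-S K)) :=
  Summable.of_nonneg_of_le
    (fun K => by have : Real.exp (-S K) ≤ 1 := Real.exp_le_one_iff.2 (by linarith [hS0 K]); linarith)
    (fun K => by have := Real.add_one_le_exp (-S K); linarith) hS

/-! ## §1 The abstract pinned-class bound (R3a): a bundled KP polymer gas with a pinned set -/

/-- A **pinned polymer gas**: a hard-core polymer system (`PolymerGas`: polymers `P`, reflexive symmetric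
incompatibility `inc`) with NON-NEGATIVE REAL activities `x`, a Kotecký–Preiss size function `a`, a finite volume `Λ`
and a pinned set of polymers `D ⊆ Λ` (in the application: the large-field structures created before the recent window
and pending at the end of the run).  Pure data + the two sign/containment conditions; the KP condition is the separate
`Prop` `PinnedGas.IsKP`.  Abstract finite combinatorics — nothing about [Balaban1989LargeFieldII] is asserted.
[folklore] -/
structure PinnedGas : Type 1 where
  /-- the polymers -/
  P : Type
  /-- decidable equality of polymers -/
  [decEq : DecidableEq P]
  /-- the incompatibility relation -/
  inc : P → P → Prop
  /-- … decidable -/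
  [decRel : DecidableRel inc]
  /-- … reflexive -/
  [refl : Std.Refl inc]
  /-- … symmetric -/
  [symm : Std.Symm inc]
  /-- the (real) activities -/
  x : P → ℝ
  /-- the Kotecký–Preiss size function -/
  a : P → ℝ
  /-- the volume -/
  Λ : Finset P
  /-- the pinned polymers -/
  D : Finset P
  /-- activities are non-negative -/
  x_nonneg : ∀ γ, 0 ≤ x γ
  /-- the pinned polymers lie in the volume -/
  D_subset : D ⊆ Λ

namespace PinnedGas

/-- The bundled decidable equality of polymers. [folklore] -/
instance instDecidableEqP (G : PinnedGas) : DecidableEq G.P := G.decEq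

/-- The bundled decidability of the incompatibility relation. [folklore] -/
instance instDecidableRelInc (G : PinnedGas) : DecidableRel G.inc := G.decRel

/-- The bundled reflexivity of the incompatibility relation. [folklore] -/
instance instReflInc (G : PinnedGas) : Std.Refl G.inc := G.refl

/-- The bundled symmetry of the incompatibility relation. [folklore] -/
instance instSymmInc (G : PinnedGas) : Std.Symm G.inc := G.symm

variable (G : PinnedGas)

/-- The activities as complex numbers (the tree's `polymerPartitionFunction` is over `ℂ`). [folklore] -/
def w : G.P → ℂ := fun γ => (G.x γ : ℂ)

/-- The (real) partition function of a sub-volume. [folklore] -/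
def Z (Λ' : Finset G.P) : ℝ := (polymerPartitionFunction G.inc G.w Λ').re

/-- The total weight `Z(Λ)`. [folklore] -/
def total : ℝ := G.Z G.Λ

/-- The good weight `Z(Λ ∖ D)`: compatible families avoiding the pinned polymers. [folklore] -/
def good : ℝ := G.Z (G.Λ \ G.D)

/-- The bad weight `Z(Λ) − Z(Λ ∖ D)`: compatible families meeting the pinned set. [folklore] -/
def bad : ℝ := G.total - G.good

/-- The pinned size `Σ_{γ ∈ D} ‖w γ‖ e^{a γ}` ([KoteckyPreiss1986] (1) summands over the pinned set). [folklore] -/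
def pinnedSize : ℝ := ∑ γ ∈ G.D, kpTerm G.w G.a γ

/-- The Kotecký–Preiss condition on the volume ([KoteckyPreiss1986] (1), finite-volume form of the tree). [folklore] -/
def IsKP : Prop := IsKPVolume G.inc G.w G.a G.Λ

/-- The complexified activities are real. [folklore] -/
theorem w_im (γ : G.P) : (G.w γ).im = 0 := by simp [w]

/-- … and non-negative. [folklore] -/
theorem w_re_nonneg (γ : G.P) : 0 ≤ (G.w γ).re := by simpa [w] using G.x_nonneg γ

/-- `1 ≤ Z(Λ')` for every sub-volume (non-negative activities; the empty family contributes `1`). [folklore] -/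
theorem one_le_Z (Λ' : Finset G.P) : 1 ≤ G.Z Λ' :=
  one_le_re_polymerPartitionFunction G.w_im G.w_re_nonneg Λ'

/-- `0 < Z(Λ')`. [folklore] -/
theorem Z_pos (Λ' : Finset G.P) : 0 < G.Z Λ' := lt_of_lt_of_le one_pos (G.one_le_Z Λ')

/-- The complex partition function is the cast of the real one. [folklore] -/
theorem Z_cast (Λ' : Finset G.P) : polymerPartitionFunction G.inc G.w Λ' = ((G.Z Λ' : ℝ) : ℂ) :=
  Complex.ext (by simp [Z]) (by simp [Z, im_polymerPartitionFunction_eq_zero G.w_im Λ'])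

/-- `0 < total`. [folklore] -/
theorem total_pos : 0 < G.total := G.Z_pos _

/-- `good ≤ total` (sub-volumes of non-negative gases have smaller partition functions). [folklore] -/
theorem good_le_total : G.good ≤ G.total :=
  re_polymerPartitionFunction_mono G.w_im G.w_re_nonneg Finset.sdiff_subset

/-- `0 ≤ bad`. [folklore] -/
theorem bad_nonneg : 0 ≤ G.bad := sub_nonneg.2 G.good_le_total

/-- `bad ≤ total`. [folklore] -/
theorem bad_le_total : G.bad ≤ G.total := by
  have := (G.Z_pos (G.Λ \ G.D)).le
  simp only [bad, good] at *
  linarith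

/-- `0 ≤ pinnedSize`. [folklore] -/
theorem pinnedSize_nonneg : 0 ≤ G.pinnedSize := Finset.sum_nonneg fun γ _ => kpTerm_nonneg _ _ γ

/-- THE RATIO BOUND, real form: under the KP condition `exp(−pinnedSize) · total ≤ good` — the tree's
`le_norm_polymerPartitionFunction_sdiff_div_of_kp` (telescoped [KoteckyPreiss1986]-type ratio bound, Friedli–Velenik
(5.29)) read for real positive partition functions. [cite: KoteckyPreiss1986, Theorem p. 492 (zero-freeness + ratio)] -/
theorem exp_neg_pinnedSize_mul_total_le_good (hKP : G.IsKP) : Real.exp (-G.pinnedSize) * G.total ≤ G.good := by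
  have h := le_norm_polymerPartitionFunction_sdiff_div_of_kp hKP subset_rfl G.D_subset
  rw [G.Z_cast, G.Z_cast, ← Complex.ofReal_div, Complex.norm_real, Real.norm_eq_abs,
    abs_of_pos (div_pos (G.Z_pos _) (G.Z_pos _))] at h
  exact (le_div_iff₀ (G.Z_pos _)).1 h

/-- **R3a — the abstract pinned-class bound.** Under the Kotecký–Preiss condition the compatible families meeting the
pinned set carry relative weight at most `1 − exp(−Σ_{γ ∈ D} ‖w γ‖ e^{a γ})`:
`bad ≤ (1 − e^{−pinnedSize}) · total`. [cite: KoteckyPreiss1986, Theorem p. 492 (zero-freeness + ratio)] -/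
theorem bad_le_of_kp (hKP : G.IsKP) : G.bad ≤ (1 - Real.exp (-G.pinnedSize)) * G.total := by
  have := G.exp_neg_pinnedSize_mul_total_le_good hKP
  simp only [bad]
  linarith

/-- … hence `bad ≤ pinnedSize · total` (the linearised form). [folklore] -/
theorem bad_le_pinnedSize_mul (hKP : G.IsKP) : G.bad ≤ G.pinnedSize * G.total :=
  (G.bad_le_of_kp hKP).trans (mul_le_mul_of_nonneg_right
    (by have := Real.add_one_le_exp (-G.pinnedSize); linarith) G.total_pos.le)

/-- Monotonicity in the pinned size: if `pinnedSize ≤ S` then `bad ≤ (1 − e^{−S}) · total`. [folklore] -/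
theorem bad_le_of_kp_of_le (hKP : G.IsKP) {S : ℝ} (hS : G.pinnedSize ≤ S) :
    G.bad ≤ (1 - Real.exp (-S)) * G.total := by
  refine (G.bad_le_of_kp hKP).trans (mul_le_mul_of_nonneg_right ?_ G.total_pos.le)
  have : Real.exp (-S) ≤ Real.exp (-G.pinnedSize) := Real.exp_le_exp.2 (by linarith)
  linarith

end PinnedGas

/-! ## §2 The representation hypothesis (R3b, NOT PRINTED) and the liaison to `RelWeightBound` -/

/-- **R3b — the polymer representation of one run's hybrid term family (HYPOTHESIS SHAPE, NOT PRINTED, NOT ASSERTED).**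
For every step `K` and every `|t| ≤ l₀`: the bad class lies in the term family, and there are a pinned polymer gas `G`
satisfying the Kotecký–Preiss condition and a constant `c ≥ 0` with `Σ_{τ ∈ T K} A K t τ = c · Z(Λ)`,
`Σ_{τ ∈ Bad K t} A K t τ = c · (Z(Λ) − Z(Λ ∖ D))` and pinned size `≤ S K`.  What B16 prints towards it, per step, is the
polymer expansion (1.90) with the activity bound (1.92) (module docstring, [R] p. 388); the fixed-`(K, t)` history-indexed
version, the sign of the weights at real `t`, and the interaction with the 𝐑-exponentiation are the unprinted content
(T4-EST-U5c.md R3b).  HYPOTHESIS SHAPE ONLY: the tag below is `folklore` on purpose — (1.90) p. 388 of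
[Balaban1989LargeFieldII] is quoted in the module docstring as the printed per-step ingredient and is NOT cited as stating
this structure (cell rule: never widen a citation). [folklore] -/
structure PolymerRep {ι : Type*} (l₀ : ℝ) (T : ℕ → Finset ι) (A : ℕ → ℝ → ι → ℝ) (Bad : ℕ → ℝ → Finset ι)
    (S : ℕ → ℝ) : Prop where
  /-- the bad class consists of terms -/
  bad_subset : ∀ K t, |t| ≤ l₀ → Bad K t ⊆ T K
  /-- the pinned-gas representation at fixed `(K, t)` -/
  rep : ∀ K t, |t| ≤ l₀ → ∃ G : PinnedGas, ∃ c : ℝ, 0 ≤ c ∧ G.IsKP ∧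
    ∑ τ ∈ T K, A K t τ = c * G.total ∧ ∑ τ ∈ Bad K t, A K t τ = c * G.bad ∧ G.pinnedSize ≤ S K

section Liaison

variable {ι : Type*} {l₀ : ℝ} {T : ℕ → Finset ι} {A B : ℕ → ℝ → ι → ℝ} {Bad : ℕ → ℝ → Finset ι} {S : ℕ → ℝ}

/-- One run: the representation gives the relative bound `Σ_{Bad} A ≤ (1 − e^{−S K}) · Σ_{T} A`. [folklore] -/
theorem PolymerRep.bad_le (h : PolymerRep l₀ T A Bad S) (K : ℕ) (t : ℝ) (ht : |t| ≤ l₀) :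
    ∑ τ ∈ Bad K t, A K t τ ≤ (1 - Real.exp (-S K)) * ∑ τ ∈ T K, A K t τ := by
  obtain ⟨G, c, hc, hKP, hT, hB, hS⟩ := h.rep K t ht
  rw [hT, hB, mul_left_comm]
  exact mul_le_mul_of_nonneg_left (G.bad_le_of_kp_of_le hKP hS) hc

/-- **THE LIAISON (R3a + R3b ⇒ NE7b's output shape).** Polymer representations of both runs with a common pinned-size
majorant `S ≥ 0`, `Σ_K S K < ∞`, give `RelWeightBound l₀ T A B Bad (fun K ↦ 1 − exp(−S K))`: the weights are `< 1`
automatically and summable by `1 − e^{−S} ≤ S`. [folklore] -/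
theorem relWeightBound_of_polymerRep (hS0 : ∀ K, 0 ≤ S K) (hS : Summable S) (hA : PolymerRep l₀ T A Bad S)
    (hB : PolymerRep l₀ T B Bad S) : RelWeightBound l₀ T A B Bad (fun K => 1 - Real.exp (-S K)) where
  bad_subset := hA.bad_subset
  nonneg K := by have : Real.exp (-S K) ≤ 1 := Real.exp_le_one_iff.2 (by linarith [hS0 K]); linarith
  lt_one K := weightKP_lt_one (S K)
  summable := summable_weightKP hS0 hS
  bad_left K t ht := hA.bad_le K t ht
  bad_right K t ht := hB.bad_le K t ht

/-- The weight-slot function of the KP weights is `K ↦ S K / vol`. [folklore] -/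
theorem weightSlot_fun_eq (S : ℕ → ℝ) (vol : ℝ) :
    (fun K => -Real.log (1 - (1 - Real.exp (-S K))) / vol) = fun K => S K / vol := by
  funext K; rw [neg_log_one_sub_weightKP]

/-- The crossover majorant with slot `S K / vol` is the hybrid remainder sequence of the slot-free crossover majorant with
the KP weights `1 − e^{−S K}` (`T4WeightBudget.crossoverDelta_weightSlot` + the slot identity). [folklore] -/
theorem crossoverDelta_kpSlot (E a θ Λ R₁ C vol : ℝ) (κ₀ : ℕ) (gs : ℕ → ℕ → ℝ) (S : ℕ → ℝ) :
    crossoverDelta E a θ Λ R₁ C κ₀ gs (fun K => S K / vol) =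
      hybridDelta vol (crossoverDelta E a θ Λ R₁ C κ₀ gs 0) (fun K => 1 - Real.exp (-S K)) := by
  rw [← weightSlot_fun_eq S vol, crossoverDelta_weightSlot]

variable [DecidableEq ι] {vol : ℝ}

/-- **The analytic end of the uniqueness spine with NE7b discharged down to the representation R3b** (=
`T4WeightBudget.cauchySum_of_crossover_relWeightBound` ∘ `relWeightBound_of_polymerRep`, slot rewritten by
`weightSlot_fun_eq`): node U4′'s crossover hypotheses, polymer representations of both runs with a summable pinned-size
majorant `S` (nodes U5c: R1 + R2 + R4 deliver `S`, R3b the representation), and the good-class sandwich (nodes U5b/U4′)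
give matching modulo constants with remainders `crossoverDelta … (fun K ↦ S K / vol)`, their summability, the Cauchy
property of every generating-function sequence on `|t| ≤ l₀` and uniform convergence there.  Every named estimate is a
hypothesis. [folklore] -/
theorem cauchySum_of_crossover_polymerRep {E a θ Λ b β' R₁ C : ℝ} {κ₀ : ℕ} {g : ℕ → ℝ} {gs : ℕ → ℕ → ℝ}
    {Z : ℕ → ℝ → ℝ} (ha0 : 0 < a) (ha1 : a < 1) (hθ : 0 < θ) (hθ1 : θ < 1) (hθΛ : θ ≤ Λ) (hb : 0 < b)
    (h031 : ∀ K, Step.Discrete031 b β' K (g K) (gs K)) (hgs : ∀ K k, k ≤ K → 0 ≤ gs K k) (hR₁ : 0 ≤ R₁)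
    (hC : 0 ≤ C) (hκ : 4 < κ₀) (hvol : 0 < vol) (hl₀ : 0 ≤ l₀)
    (hS0 : ∀ K, 0 ≤ S K) (hS : Summable S) (hPA : PolymerRep l₀ T A Bad S) (hPB : PolymerRep l₀ T B Bad S)
    (hZA : ∀ K t, |t| ≤ l₀ → Z K t = ∑ τ ∈ T K, A K t τ)
    (hZB : ∀ K t, |t| ≤ l₀ → Z (K + 1) t = ∑ τ ∈ T K, B K t τ)
    (hA : ∀ K t, |t| ≤ l₀ → ∀ τ ∈ T K, 0 ≤ A K t τ) (hB : ∀ K t, |t| ≤ l₀ → ∀ τ ∈ T K, 0 ≤ B K t τ)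
    (hpos : ∀ K t, |t| ≤ l₀ → 0 < ∑ τ ∈ T K, A K t τ)
    (hgood : ∀ K : ℕ, ∃ c : ℝ, ∀ t : ℝ, |t| ≤ l₀ → ∀ τ ∈ T K \ Bad K t,
      Real.exp (c - vol * crossoverDelta E a θ Λ R₁ C κ₀ gs 0 K) * A K t τ ≤ B K t τ ∧
        B K t τ ≤ Real.exp (c + vol * crossoverDelta E a θ Λ R₁ C κ₀ gs 0 K) * A K t τ) :
    MatchingModConstants vol l₀ (crossoverDelta E a θ Λ R₁ C κ₀ gs (fun K => S K / vol)) Z ∧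
    Summable (crossoverDelta E a θ Λ R₁ C κ₀ gs (fun K => S K / vol)) ∧
    (∀ t : ℝ, |t| ≤ l₀ → CauchySeq fun K => genFun Z K t) ∧
    TendstoUniformlyOn (fun K t => genFun Z K t) (genFunLim Z) atTop {t | |t| ≤ l₀} := by
  have h := cauchySum_of_crossover_relWeightBound (vol := vol) ha0 ha1 hθ hθ1 hθΛ hb h031 hgs hR₁ hC hκ hvol hl₀
    (relWeightBound_of_polymerRep hS0 hS hPA hPB) hZA hZB hA hB hpos hgood
  rw [weightSlot_fun_eq] at h
  exact h

end Liaison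

/-! ## §3 Sanity instances (the shapes are inhabited; abstract, nothing about B16) -/

/-- The one-polymer pinned gas: one polymer of activity `x ≥ 0`, pinned, size function `a`. [folklore] -/
def onePolymerGas (x a : ℝ) (hx : 0 ≤ x) : PinnedGas where
  P := Unit
  inc := fun _ _ => True
  decRel := fun _ _ => inferInstanceAs (Decidable True)
  refl := ⟨fun _ => trivial⟩
  symm := ⟨fun _ _ _ => trivial⟩
  x := fun _ => x
  a := fun _ => a
  Λ := {()}
  D := {()}
  x_nonneg := fun _ => hx
  D_subset := subset_rfl

/-- In the one-polymer gas `total = 1 + x`, `good = 1`, `bad = x`: the pinned class is the one family `{γ}`.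
[folklore] -/
theorem onePolymerGas_bad (x a : ℝ) (hx : 0 ≤ x) : (onePolymerGas x a hx).bad = x := by
  change (polymerPartitionFunction (fun _ _ : Unit => True) (fun _ => (x : ℂ)) {()}).re -
      (polymerPartitionFunction (fun _ _ : Unit => True) (fun _ => (x : ℂ)) ({()} \ {()})).re = x
  rw [Finset.sdiff_self, polymerPartitionFunction_empty, ← Finset.insert_empty,
    polymerPartitionFunction_insert (fun _ _ _ => trivial) _ (Finset.notMem_empty ())]
  simp

/-- … and its KP condition reads `x · e^{a} ≤ a` (e.g. `a = 1`, `x ≤ e^{−1}`), under which `bad_le_of_kp` gives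
`x ≤ (1 − e^{−x e^{a}})(1 + x)`. [folklore] -/
theorem onePolymerGas_isKP {x a : ℝ} (hx : 0 ≤ x) (h : x * Real.exp a ≤ a) : (onePolymerGas x a hx).IsKP := by
  intro γ _
  change ∑ γ' ∈ ({()} : Finset Unit) with True, kpTerm (fun _ => (x : ℂ)) (fun _ => a) γ' ≤ a
  rw [Finset.filter_true_of_mem (fun _ _ => trivial), Finset.sum_singleton]
  simp only [kpTerm, Complex.norm_real, Real.norm_eq_abs, abs_of_nonneg hx]
  exact h

/-- EMPTY PINNED SET ⇒ ZERO WEIGHT: a representation with `D = ∅` at every `(K, t)` has pinned size `0`, so the trivial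
(no old pending structure) steps cost nothing — consistent with `T4WeightBudget.relWeightBound_of_eventually`'s early-`K`
device. [folklore] -/
theorem PinnedGas.pinnedSize_eq_zero_of_empty (G : PinnedGas) (h : G.D = ∅) : G.pinnedSize = 0 := by
  simp [PinnedGas.pinnedSize, h]


/-! ## §4 (v2) R3b in DOMINATION form — `PolymerDom` (what NE7b needs; GAPS G-pv05g5-3) and its liaison -/

/-- **R3b IN DOMINATION FORM (v2; HYPOTHESIS SHAPE, NOT PRINTED, NOT ASSERTED).**  At each fixed `(K, t)`, `|t| ≤ l₀`,
there are a KP pinned gas `G` and `c ≥ 0` such that the bad class of the run's hybrid term family is DOMINATED by the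
pinned class, `Σ_{τ ∈ Bad K t} A K t τ ≤ c · G.bad`, the whole family dominates the gas, `c · G.total ≤ Σ_{τ ∈ T K} A K t τ`,
and the pinned size is `≤ S K`.  This is the Peierls / conditional-ratio form of the cell's R3b (T4-EST-U5c.md §8, GAPS
G-pv05g5-3): no exact hard-core factorisation of the positive history weights is asked for (distinct large-field
structures are softly coupled in Bałaban's expansion; an exact polymer representation exists only after a Mayer expansion
that makes activities signed — (1.91) p. 388).  `PolymerRep` (§2) is the over-typed exact special case
(`PolymerRep.toDom`).  HYPOTHESIS SHAPE ONLY; nothing of [Balaban1989LargeFieldII] is cited as stating it. [folklore] -/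
structure PolymerDom {ι : Type*} (l₀ : ℝ) (T : ℕ → Finset ι) (A : ℕ → ℝ → ι → ℝ) (Bad : ℕ → ℝ → Finset ι)
    (S : ℕ → ℝ) : Prop where
  /-- the bad class consists of terms -/
  bad_subset : ∀ K t, |t| ≤ l₀ → Bad K t ⊆ T K
  /-- domination by a KP pinned gas at fixed `(K, t)` -/
  dom : ∀ K t, |t| ≤ l₀ → ∃ G : PinnedGas, ∃ c : ℝ, 0 ≤ c ∧ G.IsKP ∧
    ∑ τ ∈ Bad K t, A K t τ ≤ c * G.bad ∧ c * G.total ≤ ∑ τ ∈ T K, A K t τ ∧ G.pinnedSize ≤ S K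

section Domination

variable {ι : Type*} {l₀ : ℝ} {T : ℕ → Finset ι} {A B : ℕ → ℝ → ι → ℝ} {Bad : ℕ → ℝ → Finset ι} {S S' : ℕ → ℝ}

/-- An exact representation is a domination. [folklore] -/
theorem PolymerRep.toDom (h : PolymerRep l₀ T A Bad S) : PolymerDom l₀ T A Bad S where
  bad_subset := h.bad_subset
  dom K t ht := by
    obtain ⟨G, c, hc, hKP, hT, hB, hS⟩ := h.rep K t ht
    exact ⟨G, c, hc, hKP, hB.le, hT.symm.le, hS⟩

/-- Domination is monotone in the pinned-size majorant. [folklore] -/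
theorem PolymerDom.mono (h : PolymerDom l₀ T A Bad S) (hSS : ∀ K, S K ≤ S' K) : PolymerDom l₀ T A Bad S' where
  bad_subset := h.bad_subset
  dom K t ht := by
    obtain ⟨G, c, hc, hKP, hB, hT, hS⟩ := h.dom K t ht
    exact ⟨G, c, hc, hKP, hB, hT, hS.trans (hSS K)⟩

/-- One run: domination gives the relative bound `Σ_{Bad} A ≤ (1 − e^{−S K}) · Σ_{T} A` — the three-line chain
`Σ_{Bad} A ≤ c·bad ≤ c·(1 − e^{−S K})·total ≤ (1 − e^{−S K})·Σ_{T} A` (R3a `PinnedGas.bad_le_of_kp_of_le`; `0 ≤ S K` is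
automatic from `0 ≤ pinnedSize ≤ S K`). [folklore] -/
theorem PolymerDom.bad_le (h : PolymerDom l₀ T A Bad S) (K : ℕ) (t : ℝ) (ht : |t| ≤ l₀) :
    ∑ τ ∈ Bad K t, A K t τ ≤ (1 - Real.exp (-S K)) * ∑ τ ∈ T K, A K t τ := by
  obtain ⟨G, c, hc, hKP, hB, hT, hS⟩ := h.dom K t ht
  have hW0 : 0 ≤ 1 - Real.exp (-S K) := by
    have : Real.exp (-S K) ≤ 1 := Real.exp_le_one_iff.2 (by linarith [G.pinnedSize_nonneg.trans hS])
    linarith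
  calc ∑ τ ∈ Bad K t, A K t τ ≤ c * G.bad := hB
    _ ≤ c * ((1 - Real.exp (-S K)) * G.total) := mul_le_mul_of_nonneg_left (G.bad_le_of_kp_of_le hKP hS) hc
    _ = (1 - Real.exp (-S K)) * (c * G.total) := by ring
    _ ≤ (1 - Real.exp (-S K)) * ∑ τ ∈ T K, A K t τ := mul_le_mul_of_nonneg_left hT hW0

/-- **THE LIAISON IN DOMINATION FORM (R3a + R3b-dom ⇒ NE7b's output shape).**  Dominations of both runs with a common
pinned-size majorant `S ≥ 0`, `Σ_K S K < ∞`, give `RelWeightBound l₀ T A B Bad (fun K ↦ 1 − exp(−S K))` — the weights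
`< 1` automatically, summable by `1 − e^{−S} ≤ S`; this is the instantiation target of row T4-U5.E. [folklore] -/
theorem relWeightBound_of_polymerDom (hS0 : ∀ K, 0 ≤ S K) (hS : Summable S) (hA : PolymerDom l₀ T A Bad S)
    (hB : PolymerDom l₀ T B Bad S) : RelWeightBound l₀ T A B Bad (fun K => 1 - Real.exp (-S K)) where
  bad_subset := hA.bad_subset
  nonneg K := by have : Real.exp (-S K) ≤ 1 := Real.exp_le_one_iff.2 (by linarith [hS0 K]); linarith
  lt_one K := weightKP_lt_one (S K)
  summable := summable_weightKP hS0 hS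
  bad_left K t ht := hA.bad_le K t ht
  bad_right K t ht := hB.bad_le K t ht

variable [DecidableEq ι] {vol : ℝ}

/-- **The analytic end of the uniqueness spine with NE7b discharged down to the DOMINATION R3b** (=
`T4WeightBudget.cauchySum_of_crossover_relWeightBound` ∘ `relWeightBound_of_polymerDom`, slot rewritten by
`weightSlot_fun_eq`): as `cauchySum_of_crossover_polymerRep` with `PolymerDom` in place of `PolymerRep`.  Every named
estimate is a hypothesis. [folklore] -/
theorem cauchySum_of_crossover_polymerDom {E a θ Λ b β' R₁ C : ℝ} {κ₀ : ℕ} {g : ℕ → ℝ} {gs : ℕ → ℕ → ℝ}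
    {Z : ℕ → ℝ → ℝ} (ha0 : 0 < a) (ha1 : a < 1) (hθ : 0 < θ) (hθ1 : θ < 1) (hθΛ : θ ≤ Λ) (hb : 0 < b)
    (h031 : ∀ K, Step.Discrete031 b β' K (g K) (gs K)) (hgs : ∀ K k, k ≤ K → 0 ≤ gs K k) (hR₁ : 0 ≤ R₁)
    (hC : 0 ≤ C) (hκ : 4 < κ₀) (hvol : 0 < vol) (hl₀ : 0 ≤ l₀)
    (hS0 : ∀ K, 0 ≤ S K) (hS : Summable S) (hPA : PolymerDom l₀ T A Bad S) (hPB : PolymerDom l₀ T B Bad S)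
    (hZA : ∀ K t, |t| ≤ l₀ → Z K t = ∑ τ ∈ T K, A K t τ)
    (hZB : ∀ K t, |t| ≤ l₀ → Z (K + 1) t = ∑ τ ∈ T K, B K t τ)
    (hA : ∀ K t, |t| ≤ l₀ → ∀ τ ∈ T K, 0 ≤ A K t τ) (hB : ∀ K t, |t| ≤ l₀ → ∀ τ ∈ T K, 0 ≤ B K t τ)
    (hpos : ∀ K t, |t| ≤ l₀ → 0 < ∑ τ ∈ T K, A K t τ)
    (hgood : ∀ K : ℕ, ∃ c : ℝ, ∀ t : ℝ, |t| ≤ l₀ → ∀ τ ∈ T K \ Bad K t,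
      Real.exp (c - vol * crossoverDelta E a θ Λ R₁ C κ₀ gs 0 K) * A K t τ ≤ B K t τ ∧
        B K t τ ≤ Real.exp (c + vol * crossoverDelta E a θ Λ R₁ C κ₀ gs 0 K) * A K t τ) :
    MatchingModConstants vol l₀ (crossoverDelta E a θ Λ R₁ C κ₀ gs (fun K => S K / vol)) Z ∧
    Summable (crossoverDelta E a θ Λ R₁ C κ₀ gs (fun K => S K / vol)) ∧
    (∀ t : ℝ, |t| ≤ l₀ → CauchySeq fun K => genFun Z K t) ∧
    TendstoUniformlyOn (fun K t => genFun Z K t) (genFunLim Z) atTop {t | |t| ≤ l₀} := by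
  have h := cauchySum_of_crossover_relWeightBound (vol := vol) ha0 ha1 hθ hθ1 hθΛ hb h031 hgs hR₁ hC hκ hvol hl₀
    (relWeightBound_of_polymerDom hS0 hS hPA hPB) hZA hZB hA hB hpos hgood
  rw [weightSlot_fun_eq] at h
  exact h

end Domination

/-- SANITY (v2): a domination that is NOT an exact representation — two terms `{0, 1}` with weights `A 0 = x` (bad) and
`A 1 = 2` (good), dominated by the one-polymer gas of activity `x` with `c = 1`: `Σ_{Bad} A = x ≤ 1·bad = x` and
`1·total = 1 + x ≤ 2 + x = Σ A`, while `Σ A ≠ c·total` for every admissible `c` making the bad equality hold.  Shows the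
v2 shape is strictly more permissive on a toy family. [folklore] -/
theorem polymerDom_toy {x a : ℝ} (hx : 0 ≤ x) (hKP : x * Real.exp a ≤ a) (l₀ : ℝ) :
    PolymerDom l₀ (fun _ => ({0, 1} : Finset ℕ)) (fun _ _ τ => if τ = 0 then x else 2)
      (fun _ _ => ({0} : Finset ℕ)) (fun _ => x * Real.exp a) where
  bad_subset K t _ := by simp
  dom K t _ := by
    refine ⟨onePolymerGas x a hx, 1, zero_le_one, onePolymerGas_isKP hx hKP, ?_, ?_, ?_⟩
    · rw [Finset.sum_singleton, one_mul, onePolymerGas_bad]; simp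
    · have htot : (onePolymerGas x a hx).total = 1 + x := by
        have hb := onePolymerGas_bad x a hx
        have hg : (onePolymerGas x a hx).good = 1 := by
          change (polymerPartitionFunction (fun _ _ : Unit => True) (fun _ => (x : ℂ)) ({()} \ {()})).re = 1
          rw [Finset.sdiff_self, polymerPartitionFunction_empty]; simp
        have : (onePolymerGas x a hx).bad = (onePolymerGas x a hx).total - (onePolymerGas x a hx).good := rfl
        linarith
      rw [htot, one_mul, Finset.sum_pair (by norm_num)]
      simp only [if_true, one_ne_zero, if_false]
      linarith
    · change ∑ γ ∈ ({()} : Finset Unit), kpTerm (fun _ => (x : ℂ)) (fun _ => a) γ ≤ x * Real.exp a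
      rw [Finset.sum_singleton]
      simp [kpTerm, Complex.norm_real, Real.norm_eq_abs, abs_of_nonneg hx]

end Literature.MathematicalPhysics.QuantumFieldTheory.Balaban1983to89.T4WeightBudgetKP
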